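import Summits.QuantumFields.YangMills.Theorems.UnitScaleTiltProp8FlatPortRechartL0
import Summits.QuantumFields.YangMills.Theorems.UnitScaleTiltProp8FlatPortKernelRowsAllL
import HarnessLib

/-!
# Route `UnitScaleTilt`, crux K1 child «MinimiserStabilityRegPr» (stmt-QuantumFields-19200), v8 pillar P2 — port level, **`KernelRowsAt` AT EVERY `Adm22` FAMILY WITH
# BIG BLOCKS `L·M_h`, `L^{a} ∣`-RECHARTED, EVERY ODD `L ≥ 3`**: the twin of ✓`UnitScaleTiltProp8FlatPortRechartL0.kernelRowsAt_of_adm22_pow` with the block-size floor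
# `(hℓ : 4 ≤ ℓ)` DELETED, reading ✓`FlatPortKernelRowsAllL.kernelRowsAt_of_adm22_allL`

Cell `ym3-torus` (HUMAN RULING D-0037, YM ladder rung R3), seat `ym-inputs-p09` (cell `pub/ym-inputs`, on-call hand; ★★OWNER RULING g26-№20 L-FLOOR LEDGER item LF-1 ∕
(P2-L3); LEAD ★w5-19200 g4 board 09:30Z).  `--supports stmt-QuantumFields-19200 --as helper`; count-neutral; def-free.

WHAT IS PROVED (sorry-free; axioms standard; no definition): **`kernelRowsAt_of_adm22_pow_allL`** — the statement of the L0 file VERBATIM minus the binder `(hℓ : 4 ≤ ℓ)`; proof verbatim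
(`FlatPortRechart.adm22_of_dvd` BY NAME).
HONEST SCOPE: bookkeeping over lit-balaban's kernel-checked L3 chain (`…V1L3`, binder `4 ≤ ℓ` dropped) through the `_allL` pads; the torus-size binder `a′ + 3 ≤ m + n`
stays ((P2-small), cured by the (α) cover); constants crude (L3 coercivity `γ₀ = (1/12)²/C_E` where it enters); nothing here proves `stub_halvingStep` or the crux;
YM₃ on T³ = rung R3, NOT the Clay problem, no mass-gap claim.

References: T. Bałaban, CMP **96** (1984) 223–250 [Balaban1984PropagatorsII] (2.1)–(2.4) p.224, Cor. 2.8 (2.150)–(2.151) p.249.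
-/

set_option autoImplicit false

noncomputable section



namespace Summit.QuantumFields.YangMills.Theorems.FlatPortRechartAllL

open FlatPortRechart (adm22_of_dvd)

open Literature.MathematicalPhysics.QuantumFieldTheory.Balaban1983to89
open B5Eq117TorusCarriers (Mk)
open B5Prop12FieldsLattice (distSite)
open B6GlobalChartV1 (PV)
open B6SectADomainsV1 (Domains)
open T3ContinuumYM3Torus (T3Family)
open FlatCubeOpsText (Adm22 IsLevWeight)
open FlatOpsFromKernelRows (KernelRowsAt)
open FlatPortKernelRowsAllL (kernelRowsAt_of_adm22_allL)

/-- `1 ≤ 3` (named once). [folklore] -/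
private theorem hd3 : 1 ≤ 2 + 1 := by norm_num

/-- **`KernelRowsAt` AT EVERY ADMISSIBLE FAMILY (UNIT CUBES `Λ₀` ALLOWED — NO `Ω₁ = T`) IN THE REGISTERED TEXT's BINDER SHAPE** (`M = Lᵃ`, `a ≥ a₀ + 1`, `R ≥ R₀`; torus size `a₀ + 3 ≤ m + n` only):
re-chart with the smallest admissible big block `L·L^{a₀}` (`adm22_of_dvd`) and apply file 9's `kernelRowsAt_of_adm22`.
[cite: Balaban1984PropagatorsII, (2.1)-(2.4) p.224, Cor. 2.8 (2.150)-(2.151) p.249; Balaban1985Variational, (161)-(163) p.303] -/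
theorem kernelRowsAt_of_adm22_pow_allL (ℓ : ℕ) (hL : Odd (ℓ + 1) ∧ 1 < ℓ + 1) :
    ∃ (a₀ R₀ : ℕ) (C δ₀ B₃ CG : ℝ), 0 ≤ C ∧ 0 < δ₀ ∧ 0 < B₃ ∧ 0 ≤ CG ∧
    ∀ (m : ℕ) (hm : 1 ≤ m) (n K : ℕ) (_ : 1 ≤ K - n) (_ : K - n + 1 ≤ m + K) (_ : a₀ + 3 ≤ m + n) {R a : ℕ} (_ : a₀ + 1 ≤ a) (_ : R₀ ≤ R)
      (D : Domains (PV 2 ℓ m K hd3 hL)) (_ : D.k = K - n) (_ : Adm22 D R ((ℓ + 1) ^ a))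
      (w : ℕ → PBond (PV 2 ℓ m K hd3 hL) 0 → ℝ) (_ : IsLevWeight (⟨ℓ + 1, hL, m, hm⟩ : T3Family) n K D w),
      KernelRowsAt (⟨ℓ + 1, hL, m, hm⟩ : T3Family) n K D w C δ₀ B₃ CG := by
  obtain ⟨Mh₀, R₀, C, δ₀, B₃, CG, hC, hδ₀, hB₃, hCG, hmain⟩ := kernelRowsAt_of_adm22_allL ℓ hL
  -- `a₀ := Mh₀`: `L^{Mh₀} ≥ Mh₀`
  refine ⟨Mh₀, R₀, C, δ₀, B₃, CG, hC, hδ₀, hB₃, hCG, ?_⟩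
  intro m hm n K hk1 hk' hsize R a ha hR D hDk hAdm w hw
  have hL1 : 1 < ℓ + 1 := by omega
  have hMh : Mh₀ ≤ (ℓ + 1) ^ Mh₀ := (Nat.lt_pow_self hL1).le
  -- re-chart: `L·L^{a₀} ∣ L^a`
  have hdvd : (ℓ + 1) * (ℓ + 1) ^ Mh₀ ∣ (ℓ + 1) ^ a := by
    rw [← pow_succ']
    exact pow_dvd_pow _ (by omega)
  have hAdm' : Adm22 D R ((ℓ + 1) * (ℓ + 1) ^ Mh₀) := adm22_of_dvd hAdm hdvd
  exact hmain m hm n K hk1 hk' rfl hMh hR hsize D hDk hAdm' w hw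

end Summit.QuantumFields.YangMills.Theorems.FlatPortRechartAllL

end
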